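import Summits.BirchSwinnertonDyer.BirchSwinnertonDyer.Theorems.ErratumRoadFiveIMCDivMemberCongruenceAssembly
import Summits.BirchSwinnertonDyer.BirchSwinnertonDyer.Theorems.ErratumRoadFiveIMCDivMemberCongruenceF1
import Summits.BirchSwinnertonDyer.BirchSwinnertonDyer.Theorems.ErratumRoadFiveIMCDivMemberDivisibleMember
import HarnessLib

/-!
# K2 crux 20169 `IMCDivAtErratumDataAllR` (H3♭, re-oriented), ROAD FF v4 — stub 2: the member congruence
# `e m` AT THE ERRATUM DATA, every kernel-side input instantiated — modulo the two residual typer facts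
# (SelBC) `Sel_{𝒪⟦T⟧}(M ⊗ 𝒪) ≅ 𝒪⟦T⟧ ⊗_Λ Sel_Λ(M)` and (Frob) dual bases of `𝒪_m/ℤ_p`, and F1's two named facts

Cell `bsd-stepL`, seat `bsd-stepL-imc-p1` (g9). `--supports stmt-BirchSwinnertonDyer-20169 --as helper`.
HONEST FRAMING: CONDITIONAL on every displayed hypothesis — in particular on (SelBC) and (Frob), which are NOT
proved here, and on the named facts `SkinnerUrban2014.prop323_XAc_equiv_XBigDecomp`,
`selmerBig_eq_selmerBigDecomp_of_unramifiedOutside`; closes no item; no definition, no named fact, no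
`sorry`; BSD is proved for no pair; no census number moves (T7).

## What this file proves

`RoadFFMember.nonempty_memberCongruence` (imc-p1 g9, p502247) assembles the binder `e m` of
`P2.RoadFF.fittingCongruenceFrameTwoSlotAt_of_members_descent_le[_printed]` from abstract inputs
(F1), (SelBC), (Frob), (b), and six Lemma-2.1 divisibility hypotheses. This file instantiates it at the
erratum data for a Hida member `D : Skinner2016.HidaCongruentMember W p m` (`m ≥ 1`):
`X := AcSelmer.XAc (W.baseChange K) p κ 𝔮 Σ γ`, `ρ := (W.baseChange K).primaryTorsionGaloisRep p`,
`ρ𝒪 := ρ ⊗ 1` on `𝒪_m ⊗_{ℤ_p} E_K(K̄)[p^∞]`, `ρg := D.Δ.cofreeRepOver K`: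
* (F1) from `nonempty_XAc_equiv_XBig` (p502674; the two named facts displayed);
* (b) from `exists_torsionCongruence_baseChange` (p504901) — DISCHARGED;
* the six divisibility hypotheses from `hdiv/hglob/hloc_extendScalars_erratum`, `hdiv_cofreeRepOver`,
  `hglob/hloc_cofreeRepOver_erratum` (p505838, p506728) — DISCHARGED from the erratum's binders `Irr(E[p])`,
  `K` imaginary quadratic, (iv) `E(ℚ_p)[p] = 0` with `K_𝔮 ↪ ℚ_p`, good reduction of `E_K` outside `Σ ∪ S_p`
  (the weak form `w ∉ Σ → w ∤ p → good`, satisfiable at the erratum data where `E` is multiplicative at `p`),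
  `Σ ∋` every `w ∣ N`, `p ∣ N`;
* `Module.Free ℤ_[p] 𝒪_m` — DISCHARGED from (Frob)'s generating family (`moduleFree_of_frobData`: finite
  type + torsion-free over the PID `ℤ_p`, `algebraMap ℤ_[p] 𝒪_m` injective);
leaving EXACTLY (SelBC) and (Frob) (defn-ty1 g3's (T2), (T1)) and F1's two named facts displayed:
**`nonempty_memberCongruence_erratum`**.

References: [Castella2018Erratum] Thm. 1.1, (b), Lemma 2.1, proof of Thm. 1.1 (pp. 1–4);
[Skinner2016PacificMC] §2.3 Lemma 2.3.1, §2.6 (2-6-1), §3.1 (b)(d); [SkinnerUrban2014] Prop. 3.2.3.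
-/

set_option autoImplicit false

noncomputable section

open scoped TensorProduct Classical

open CategoryTheory PowerSeries NumberField IsDedekindDomain Field WeierstrassCurve
open Literature.NumberTheory.GaloisRepresentations Literature.NumberTheory.EllipticCurves
  Literature.NumberTheory.EllipticCurves.BigGaloisRep Literature.NumberTheory.EllipticCurves.GreenbergSelmer
  Literature.NumberTheory.EllipticCurves.Skinner2016 Literature.NumberTheory.EllipticCurves.Rank1Residual
  Literature.NumberTheory.EllipticCurves.Castella2018

namespace Summit.BirchSwinnertonDyer.Rank1Residual.X11b.RoadFFMember

/-! ### §1 `𝒪_m` is free over `ℤ_p` (from (Frob)'s generating family) -/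

section Free

variable {Γ : Subgroup (GL (Fin 2) ℝ)} {k : ℤ} {g : CuspForm Γ k} {p : ℕ} [Fact p.Prime]
  (ι : ModularForms.coeffField g →+* PadicAlgCl p)

/-- `ℤ_p → 𝒪 = padicCoeffIntegers ι` is injective (it is `ℤ_p ⊂ ℚ_p → K`, `K` a field), i.e. `𝒪` is a
torsion-free `ℤ_p`-module. [cite: EmertonPollackWeston2006, §3.1 (p. 17: `𝒪` the ring of integers of `K/ℚ_p`)] -/
theorem isTorsionFree_padicCoeffIntegers : Module.IsTorsionFree ℤ_[p] (padicCoeffIntegers ι) := by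
  refine Module.isTorsionFree_iff_algebraMap_injective.mpr ?_
  rw [padicCoeffIntegers.algebraMap_padicInt_eq]
  intro x y h
  have h' := congrArg (fun z : padicCoeffIntegers ι => (z : padicCoeffField ι)) h
  simp only [padicCoeffIntegers.coe_ofPadicInt] at h'
  exact PadicInt.ext ((algebraMap ℚ_[p] (padicCoeffField ι)).injective h')

/-- A finite family `b` with `a = ∑ t₀(a b'_i) b_i` for all `a` generates `𝒪` over `ℤ_p`: `𝒪` is a finite
`ℤ_p`-module. [cite: Skinner2016PacificMC, §2.3 (`𝒪` free of finite rank over `ℤ_p`)] -/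
theorem moduleFinite_of_frobData {ι' : Type*} [Fintype ι'] (t₀ : padicCoeffIntegers ι →ₗ[ℤ_[p]] ℤ_[p])
    (b b' : ι' → padicCoeffIntegers ι) (hfb : ∀ a : padicCoeffIntegers ι, a = ∑ i, t₀ (a * b' i) • b i) :
    Module.Finite ℤ_[p] (padicCoeffIntegers ι) :=
  Module.Finite.of_surjective (Fintype.linearCombination ℤ_[p] b) fun a =>
    ⟨fun i => t₀ (a * b' i), by rw [Fintype.linearCombination_apply]; exact (hfb a).symm⟩

/-- **`𝒪_m` is free over `ℤ_p`** given (Frob)'s generating family (finite type + torsion-free over the PID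
`ℤ_p`, Mathlib `Module.free_of_finite_type_torsion_free'`). [cite: Skinner2016PacificMC, §2.3 (`𝒪` free of finite rank over `ℤ_p`)] -/
theorem moduleFree_of_frobData {ι' : Type*} [Fintype ι'] (t₀ : padicCoeffIntegers ι →ₗ[ℤ_[p]] ℤ_[p])
    (b b' : ι' → padicCoeffIntegers ι) (hfb : ∀ a : padicCoeffIntegers ι, a = ∑ i, t₀ (a * b' i) • b i) :
    Module.Free ℤ_[p] (padicCoeffIntegers ι) := by
  haveI := moduleFinite_of_frobData ι t₀ b b' hfb
  haveI := isTorsionFree_padicCoeffIntegers ι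
  exact Module.free_of_finite_type_torsion_free'

end Free

/-! ### §2 The member congruence `e m` at the erratum data -/

section Erratum

variable {W : WeierstrassCurve ℚ} [W.IsElliptic] [W.IsGloballyMinimal] {p : ℕ} [Fact p.Prime] {m : ℕ}
  {K : Type} [Field K] [NumberField K]

/-- **THE MEMBER CONGRUENCE `e_m` AT THE ERRATUM DATA** — for a Hida member `D` of `f_E` at level `m ≥ 1`
(F2) with coefficient ring `𝒪_m`, an imaginary quadratic `K` with the Heegner hypothesis, `p ≥ 5`, `E[p]`
irreducible, (iv) `E(ℚ_p)[p] = 0` at a `𝔮 ∣ p` with `K_𝔮 ↪ ℚ_p`, a finite `Σ` away from `p` containing every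
`w ∣ N` with good reduction of `E_K` outside `Σ ∪ S_p`, `p ∣ N`, an anticyclotomic `κ` with topological generator `γ`:
`((𝒪_m⟦T⟧ ⊗_Λ X^Σ_𝔮(E/K_∞)) ⧸ ((C p)Λ·𝒪_m⟦T⟧)^m) ≃ₗ[𝒪_m⟦T⟧] (XBig κ (A_{g_m}|_{Γ_K}) 𝔮 Σ ⧸ ((C p)Λ·𝒪_m⟦T⟧)^m)` —
VERBATIM the binder `e m` of `P2.RoadFF.fittingCongruenceFrameTwoSlotAt_of_members_descent_le[_printed]` with
`X := AcSelmer.XAc (W.baseChange K) p κ 𝔮 Σ γ`, `Nm m := XBig κ (D.Δ.cofreeRepOver K) 𝔮 Σ`. CONDITIONAL on the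
displayed (F1) named facts `hSh`, `hSig`, on (SelBC) `hSelBC` and on (Frob) `t₀, b, b', hfb, hfb'`; (b), the six
Lemma-2.1 divisibility hypotheses and `Module.Free ℤ_[p] 𝒪_m` are discharged. Nothing is booked.
[cite: Castella2018Erratum, Thm. 1.1, (b), Lemma 2.1 and proof of Thm. 1.1 (pp. 1–4)]
[cite: Skinner2016PacificMC, §2.6 (2-6-1), §3.1 (b)(d)] [cite: SkinnerUrban2014, Prop. 3.2.3] -/
theorem nonempty_memberCongruence_erratum (hSh : SkinnerUrban2014.prop323_XAc_equiv_XBigDecomp)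
    (hSig : selmerBig_eq_selmerBigDecomp_of_unramifiedOutside)
    (hp : 5 ≤ p) (hirr : Irr W p) (hK : IsImaginaryQuadratic K) (hsplit : SatisfiesHeegnerHypothesis p K)
    (𝔮 : HeightOneSpectrum (𝓞 K)) (h𝔮 : ((p : ℕ) : 𝓞 K) ∈ 𝔮.asIdeal) (φ : 𝔮.adicCompletion K →+* ℚ_[p])
    (hiv : ∀ Q : (W.baseChange ℚ_[p]).toAffine.Point, p • Q = 0 → Q = 0)
    (S : Set (HeightOneSpectrum (𝓞 K))) (hSfin : S.Finite) (hSp : ∀ w ∈ S, ((p : ℕ) : 𝓞 K) ∉ w.asIdeal)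
    (hS : ∀ w : HeightOneSpectrum (𝓞 K), w ∉ S → ((p : ℕ) : 𝓞 K) ∉ w.asIdeal →
      (W.baseChange K).HasGoodReductionAt w)
    (hSN : ∀ w : HeightOneSpectrum (𝓞 K), w ∉ S → ((W.conductorNorm ℤ : ℕ) : 𝓞 K) ∉ w.asIdeal)
    (hpN : p ∣ W.conductorNorm ℤ)
    (κ : ZpExtension K p) (hκ : κ.IsAnticyclotomic) (γ : absoluteGaloisGroup K) [Fact (κ.IsTopGenerator γ)]
    (D : HidaCongruentMember W p m) (hm : 1 ≤ m)
    [TopologicalSpace (IwasawaAlgebra p)]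
    [ContinuousSMul (IwasawaAlgebra p) (BigRepModule ℤ_[p] p (PrimaryTorsion (geomPoints (W.baseChange K)) p))]
    [TopologicalSpace (PowerSeries (padicCoeffIntegers D.ι))]
    [ContinuousSMul (PowerSeries (padicCoeffIntegers D.ι)) (BigRepModule (padicCoeffIntegers D.ι) p
      (CoeffExtension ℤ_[p] (padicCoeffIntegers D.ι) (PrimaryTorsion (geomPoints (W.baseChange K)) p)))]
    [ContinuousSMul (PowerSeries (padicCoeffIntegers D.ι)) (BigRepModule (padicCoeffIntegers D.ι) p
      (Cofree D.Δ.ρ (padicCoeffField D.ι)))]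
    -- (SelBC): Selmer groups commute with the flat coefficient extension `Λ → 𝒪_m⟦T⟧`
    (hSelBC : Nonempty (selmerBig κ (ContinuousRep.extendScalars (R := ℤ_[p]) (G := absoluteGaloisGroup K)
        (A := PrimaryTorsion (geomPoints (W.baseChange K)) p) (padicCoeffIntegers D.ι)
        ((W.baseChange K).primaryTorsionGaloisRep p)) 𝔮 S ≃ₗ[PowerSeries (padicCoeffIntegers D.ι)]
      PowerSeries (padicCoeffIntegers D.ι) ⊗[IwasawaAlgebra p]
        selmerBig κ ((W.baseChange K).primaryTorsionGaloisRep p) 𝔮 S))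
    -- (Frob): dual bases of `𝒪_m` over `ℤ_p` for a `ℤ_p`-linear form `t₀`
    {ι' : Type*} [Fintype ι'] (t₀ : padicCoeffIntegers D.ι →ₗ[ℤ_[p]] ℤ_[p]) (b b' : ι' → padicCoeffIntegers D.ι)
    (hfb : ∀ a : padicCoeffIntegers D.ι, a = ∑ i, t₀ (a * b' i) • b i)
    (hfb' : ∀ a : padicCoeffIntegers D.ι, a = ∑ i, t₀ (a * b i) • b' i) :
    Nonempty ((((PowerSeries (padicCoeffIntegers D.ι)) ⊗[IwasawaAlgebra p]
          AcSelmer.XAc (W.baseChange K) p κ 𝔮 S γ) ⧸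
        (((Ideal.span {(C (p : ℤ_[p]) : IwasawaAlgebra p)}).map
            (algebraMap (IwasawaAlgebra p) (PowerSeries (padicCoeffIntegers D.ι)))) ^ m •
          (⊤ : Submodule (PowerSeries (padicCoeffIntegers D.ι))
            ((PowerSeries (padicCoeffIntegers D.ι)) ⊗[IwasawaAlgebra p] AcSelmer.XAc (W.baseChange K) p κ 𝔮 S γ))))
        ≃ₗ[PowerSeries (padicCoeffIntegers D.ι)]
      (XBig κ (D.Δ.cofreeRepOver K) 𝔮 S ⧸
        (((Ideal.span {(C (p : ℤ_[p]) : IwasawaAlgebra p)}).map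
            (algebraMap (IwasawaAlgebra p) (PowerSeries (padicCoeffIntegers D.ι)))) ^ m •
          (⊤ : Submodule (PowerSeries (padicCoeffIntegers D.ι)) (XBig κ (D.Δ.cofreeRepOver K) 𝔮 S))))) := by
  haveI : Module.Free ℤ_[p] (padicCoeffIntegers D.ι) := moduleFree_of_frobData D.ι t₀ b b' hfb
  -- (unr): inertia at every `w ∉ Σ`, `w ∤ p` acts trivially on `E_K[p^∞]` (good reduction there; Néron–Ogg–Shafarevich)
  have hunr : ∀ w : HeightOneSpectrum (𝓞 K), w ∉ S → ((p : ℕ) : 𝓞 K) ∉ w.asIdeal →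
      ∀ σ : absoluteGaloisGroup (w.adicCompletion K), σ ∈ absInertia (w.adicCompletion K) →
        ∀ P : PrimaryTorsion (geomPoints (W.baseChange K)) p,
          absGaloisRestrict K (w.adicCompletion K) σ • P = P :=
    fun w hw hpw σ hσ P =>
      BigRep.smul_primaryTorsion_eq_of_mem_absInertia_of_hasGoodReductionAt (W.baseChange K) p (hS w hw hpw)
        hpw hσ P
  -- (F1)
  have hF1 := nonempty_XAc_equiv_XBig W p K hSh hSig hp hirr hK hsplit 𝔮 h𝔮 S hSfin hSp
    (fun w hw hpw σ P => by
      obtain ⟨σ, hσ⟩ := σ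
      rw [WeierstrassCurve.primaryTorsionGaloisRep_apply]
      exact hunr w hw hpw σ hσ P)
    κ hκ γ
  exact nonempty_memberCongruence κ m ((W.baseChange K).primaryTorsionGaloisRep p)
    (ContinuousRep.extendScalars (R := ℤ_[p]) (G := absoluteGaloisGroup K)
      (A := PrimaryTorsion (geomPoints (W.baseChange K)) p) (padicCoeffIntegers D.ι)
      ((W.baseChange K).primaryTorsionGaloisRep p))
    (D.Δ.cofreeRepOver K) 𝔮 S hF1 hSelBC t₀ b b' hfb hfb' (exists_torsionCongruence_baseChange D K)
    (hdiv_extendScalars_erratum K (padicCoeffIntegers D.ι) (W := W))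
    (hglob_extendScalars_erratum K (padicCoeffIntegers D.ι) κ hK hirr m hm)
    (hloc_extendScalars (padicCoeffIntegers D.ι) (W.baseChange K) κ 𝔮 S (geomPoints_baseChange_divisible K (W := W))
      (BigRep.hdec_geomPoints_of_padicTorsion W p K 𝔮 φ hiv) hunr m hm)
    (hdiv_cofreeRepOver D.Δ)
    (hglob_cofreeRepOver_erratum D K hm κ hK hirr m hm)
    (hloc_cofreeRepOver_erratum D K hm κ 𝔮 φ S hiv hSN hpN m hm)

end Erratum

end Summit.BirchSwinnertonDyer.Rank1Residual.X11b.RoadFFMember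

end
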